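import Summits.CriticalPhenomena.PercolationContinuityZ3.Theorems.Transplant.KNCellsBoxProdZ2ChainU
import HarnessLib

/-!
# ONE target step of `X □ ℤ²` in a `U`-restricted graph from planar box data — the packaging of the FACE INPUT `hface_j` of design (D)
# (lead V56 order G4(a); HOME/ENTRY-SEED-STAR.md §11 (c5): "hface_j: ONE Lemma-10 step in the fat fresh far region above stub `j`, source = the
# face box `⊇ F^{j+1}`, target = the cross-section of `M_y` plus rim faces; the long objects are the Step-IV ROUTES (elongated, aspect `≤ 2K`),
# exactly as in the `ℤ^d` model's `cond_of_face`"; consumed by `KSchA.cond_of_step` (p217114))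

builds on p205010 (kernel theorem, internal audit signed; external expert review pending) — nothing in this file uses p205010.
Lane `prim-bschramm`, seat `prim-bschramm-p2` (G4); helper file (`--supports stmt-CriticalPhenomena-4575`).

* `UStepData` (`U`, planar source box `[lo, hi]`, planar region `Dpl`, target `T`, `Rlev N j₀ j₁`, source `root`, support `Sfin`);
  `L = uLData …` (the `U`-levels of the box), `D = U ∩ (W × Dpl)`, `ustep : TStep (restrictGraph (X □ zdGraph 2) U)`;
* `L_X` (`X_k = U ∩ (W × [lo - k, hi + k])`), `encl_of_planar` (`X_{Rlev+1} ⊆ D` from the planar containment), `box_subset_X_zero`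
  (a product set over `[lo, hi]` inside `U` lies in `X_0` — for `hface : Face^{j+1} ⊆ X_0`), **`kitsAt_ustep`**.
[cite: KozmaNitzan2024, §4 Lemma 10 (p. 17), p. 30 (Step III: Lemma 10 at the faces)]
-/

noncomputable section

open MeasureTheory ProbabilityTheory
open scoped ENNReal

namespace Summit.CriticalPhenomena.PercolationContinuityZ3.Theorems

namespace Transplant

namespace BoxProdZ2

open Literature.Probability.Percolation Literature.Probability.LatticeModels SimpleGraph
open KNLevels

variable {W : Type} (X : SimpleGraph W) [X.LocallyFinite] [DecidableEq W]

/-- **The data of one target step in a `U`-restricted graph** from planar box data. [cite: KozmaNitzan2024, §4 Lemma 10 (p. 17)] -/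
structure UStepData (W : Type) where
  /-- the world `U` (fresh region ∪ what any-path events may use) -/
  U : Finset (W × Site 2)
  /-- lower corner of the planar source box -/
  lo : Site 2
  /-- upper corner of the planar source box -/
  hi : Site 2
  /-- the planar region -/
  Dpl : Finset (Site 2)
  /-- the target (enlarged: true target ∪ rim faces) -/
  T : Finset (W × Site 2)
  /-- the level depth -/
  Rlev : ℕ
  /-- the number of contacts demanded by Step II -/
  N : ℕ
  /-- the level window -/
  j₀ : ℕ
  /-- the level window -/
  j₁ : ℕ
  /-- the source -/
  root : W × Site 2
  /-- the finite support of the weighting -/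
  Sfin : Finset (W × Site 2)

namespace UStepData

variable {X} (P : UStepData W)

variable (X) in
/-- The level data: the `U`-levels of the planar box. [cite: KozmaNitzan2024, §4 Lemma 10 (p. 17)] -/
def L : LData (restrictGraph (X □ zdGraph 2) P.U) := uLData X P.U P.lo P.hi P.root P.Sfin

/-- The region: `U ∩ (W × Dpl)`. [cite: KozmaNitzan2024, §4 Lemma 10 (p. 17: D)] -/
def D : Finset (W × Site 2) := uSlice P.U P.Dpl

variable (X) in
/-- **The step.** [cite: KozmaNitzan2024, §4 Lemma 10 (p. 17)] -/
def ustep : TStep (restrictGraph (X □ zdGraph 2) P.U) := ⟨P.L X, P.D, P.T, P.Rlev, P.N, P.j₀, P.j₁⟩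

omit [X.LocallyFinite] [DecidableEq W] in
/-- The levels: `X_k = U ∩ (W × [lo - k, hi + k])`. [cite: KozmaNitzan2024, §4 p. 15 (B⟨j⟩)] -/
theorem L_X (k : ℕ) : (P.L X).X k = uSlice P.U (Finset.Icc (P.lo - (k : Site 2)) (P.hi + (k : Site 2))) := by
  rw [L, uLData_X, uLevel_eq_uSlice]

omit [X.LocallyFinite] [DecidableEq W] in
/-- The source of the step. [folklore] -/
theorem ustep_o : (P.ustep X).L.o = P.root := rfl

omit [X.LocallyFinite] [DecidableEq W] in
/-- The target of the step. [folklore] -/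
theorem ustep_T : (P.ustep X).T = P.T := rfl

variable {P}

omit [X.LocallyFinite] [DecidableEq W] in
/-- **`X_{Rlev+1} ⊆ D`** from the planar containment `[lo - (Rlev+1), hi + (Rlev+1)] ⊆ Dpl`. [cite: KozmaNitzan2024, §4 Lemma 10 (p. 17: B⟨R+1⟩ ⊆ D)] -/
theorem encl_of_planar (h : Finset.Icc (P.lo - ((P.Rlev + 1 : ℕ) : Site 2)) (P.hi + ((P.Rlev + 1 : ℕ) : Site 2)) ⊆ P.Dpl) :
    (P.L X).X (P.Rlev + 1) ⊆ P.D := by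
  rw [L_X]; exact uSlice_mono P.U h

omit [X.LocallyFinite] [DecidableEq W] in
/-- **A subset of `U` over the planar box lies in `X_0`** (for `hface : Face^{j+1} ⊆ X_0`). [folklore] -/
theorem subset_X_zero {F : Finset (W × Site 2)} (hFU : F ⊆ P.U) (hF : ∀ v ∈ F, v.2 ∈ Finset.Icc P.lo P.hi) : F ⊆ (P.L X).X 0 := by
  rw [L_X]
  intro v hv
  refine (mem_uSlice_iff).2 ⟨hFU hv, ?_⟩
  simpa using hF v hv

/-- **`KitsAt` of the step** from a subbox region, finite support, the source off the region, the planar enclosure, `T ⊆ D` nonempty, the count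
inequality and the per-level kit clause (towards the enlarged target; the routes are the instance's elongated ones). [cite: KozmaNitzan2024, §4 Lemma 10 (p. 17)] -/
theorem kitsAt_ustep {Wt : Sym2 (W × Site 2) → unitInterval} {p : unitInterval} {Δ : ℕ} {δ : ℝ}
    (hsub : KNLevels.IsSubbox (restrictGraph (X □ zdGraph 2) P.U) Wt p P.D) (hfin : FinSupp Wt P.Sfin) (hDS : P.D ⊆ P.Sfin)
    (hencl : Finset.Icc (P.lo - ((P.Rlev + 1 : ℕ) : Site 2)) (P.hi + ((P.Rlev + 1 : ℕ) : Site 2)) ⊆ P.Dpl)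
    (ho : P.root ∉ P.D) (hoS : P.root ∈ P.Sfin) (hj : P.j₁ ≤ P.Rlev) (hTD : P.T ⊆ P.D) (hTne : P.T.Nonempty)
    (hcount : 1 / (1 - (p : ℝ)) ^ (Δ * P.N) ≤ δ * ((Finset.Icc P.j₀ P.j₁).card : ℝ))
    (hkits : ∀ j ∈ Finset.Icc P.j₀ P.j₁, ∃ (σ : SData (W × Site 2)) (S : Finset (W × Site 2)), SHyp (P.L X) j σ ∧ σ.N ≤ P.N ∧
      (1 - (p : ℝ) ^ σ.sB) ^ σ.k ≤ δ ∧ S ⊆ (P.L X).X j ∧ S ⊆ P.D ∧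
      (∀ x ∈ σ.K, ∀ e ∈ σ.seed x, e ∉ wireSet (↑S : Set (W × Site 2))) ∧ (∀ x ∈ σ.K, σ.face x ⊆ S) ∧
      (∀ x ∈ σ.K, 1 - 3 * δ ≤ (prodBernoulli Wt).real {ω | ∃ u ∈ σ.face x,
        1 - δ < (prodBernoulli (pinW Wt (wireSet (↑S : Set (W × Site 2))) ω)).real
          (⋃ t ∈ P.T, openConnIn (↑P.D : Set (W × Site 2)) u t)})) :
    (P.ustep X).KitsAt Wt p Δ δ :=
  ⟨lhyp_U X P.U P.lo P.hi hsub hfin hDS (encl_of_planar (X := X) hencl) ho hoS, hj, hTD, hTne, hcount, hkits⟩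

end UStepData

end BoxProdZ2

end Transplant

end Summit.CriticalPhenomena.PercolationContinuityZ3.Theorems

end
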